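import Literature.Geometry.Manifold.ShellInterpolatedIsotopyPunctured
import HarnessLib

/-!
# Interpolating two isotopies across a shell — the inverse map covers the opposite rotation

General topology; theorems only (no definition, no named fact). Complement to `ShellInterpolatedIsotopyPunctured`: there the
explicit two-sided inverse `k(u, x') = I(−2πu(1−λ(ρx')), g(−2πuλ(ρx'), x'))` (`ρ x' ≤ R'`), `g(−2πu, x')` (otherwise) of the
interpolated isotopy `h(u, ·)` is shown to satisfy `k(u, h(u, x)) = x`, `h(u, k(u, x')) = x'`. Here we record that **`k(u, ·)` itself
covers the rotation by `−2πu` and preserves `ρ` below `R`** (`apply_shellInverse'`) — so that `k(u, ·)` carries the fibre over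
`e^{2πiu}c` back INTO the fibre over `c`, which makes `h(u, ·) : X_c → X_{e^{2πiu}c}` surjective (and not merely injective); this is
the bijectivity of the fibre maps used with `DirectImageIsotopy` (injectivity on cohomology of a homeomorphism between compact
fibres). Same hypotheses and notation as `apply_shellIsotopy'` (Arnold–Gusein-Zade–Varchenko II §1.1; Milnor §9).

## References

* [ArnoldGuseinzadeVarchenko2012] V. I. Arnold, S. M. Gusein-Zade, A. N. Varchenko, Singularities of Differentiable Maps,
  Vol. 2, Part I §1.1 (held text p0013, p0025).
* [Milnor1968] J. Milnor, Singular Points of Complex Hypersurfaces, §9 Lemma 9.4.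
-/

noncomputable section

open Set Function Complex
open scoped Real

namespace Literature.Geometry.Manifold

section ShellInverse

variable {M : Type*} {p : M → ℂ} {ρ : M → ℝ} {J g : ℝ × M → M} {lam : ℝ → ℝ} {s₀ s₁ s₂ R' R δ : ℝ}

/-- The rotation `e^{iθ}c` composes additively in the angle. [cite: Milnor1968, §9 Lemma 9.4] -/
theorem exp_mul_I_mul_exp_mul_I_mul (a b : ℝ) (c : ℂ) :
    Complex.exp ((a : ℂ) * I) * (Complex.exp ((b : ℂ) * I) * c) = Complex.exp (((a + b : ℝ) : ℂ) * I) * c := by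
  rw [← mul_assoc, ← Complex.exp_add]
  push_cast
  ring_nf

/-- Rotations preserve the modulus. [cite: Milnor1968, §9 Lemma 9.4] -/
theorem norm_exp_ofReal_mul_I_mul (a : ℝ) (c : ℂ) : ‖Complex.exp ((a : ℂ) * I) * c‖ = ‖c‖ := by
  rw [norm_mul, Complex.norm_exp_ofReal_mul_I, one_mul]

/-- **The inverse `k(u, ·)` of the interpolated isotopy covers the rotation by `−2πu` and preserves `ρ` below `R`**: for
`‖p x‖ < δ`, `p x ≠ 0`, `p (k(u, x)) = e^{−2πiu} p x` and `ρ x < R → ρ (k(u, x)) = ρ x`.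
[cite: ArnoldGuseinzadeVarchenko2012, Part I §1.1 (held text p0013, p0025)] [cite: Milnor1968, §9 Lemma 9.4] -/
theorem apply_shellInverse' (hs₀₁ : s₀ ≤ s₁) (hs₁₂ : s₁ < s₂) (hs₂R' : s₂ ≤ R') (hR'R : R' < R)
    (hlam₀ : ∀ t, t ≤ s₁ → lam t = 0)
    (hI : ∀ θ x, ρ x < R → p x ≠ 0 → ρ (J (θ, x)) = ρ x ∧ p (J (θ, x)) = Complex.exp ((θ : ℂ) * I) * p x)
    (hg0 : ∀ q, g (0, q) = q)
    (hgO : ∀ θ q, s₀ < ρ q → ‖p q‖ < δ → s₀ < ρ (g (θ, q)) ∧ p (g (θ, q)) = Complex.exp ((θ : ℂ) * I) * p q)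
    (hgρ : ∀ θ q, s₀ < ρ q → ‖p q‖ < δ → ρ q < R → ρ (g (θ, q)) = ρ q)
    (u : ℝ) {x : M} (hx : ‖p x‖ < δ) (hx0 : p x ≠ 0) :
    p (if ρ x ≤ R' then J (-(2 * π * u * (1 - lam (ρ x))), g (-(2 * π * u * lam (ρ x)), x)) else g (-(2 * π * u), x)) =
        Complex.exp (((-(2 * π * u) : ℝ) : ℂ) * I) * p x ∧
      (ρ x < R → ρ (if ρ x ≤ R' then J (-(2 * π * u * (1 - lam (ρ x))), g (-(2 * π * u * lam (ρ x)), x))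
        else g (-(2 * π * u), x)) = ρ x) := by
  split_ifs with hxR'
  · have hxR : ρ x < R := lt_of_le_of_lt hxR' hR'R
    by_cases hx₁ : ρ x ≤ s₁
    · -- deep inside: `λ = 0`, only the model turns
      rw [hlam₀ _ hx₁, mul_zero, neg_zero, hg0, sub_zero, mul_one]
      obtain ⟨hρy, hpy⟩ := hI (-(2 * π * u)) x hxR hx0
      refine ⟨?_, fun _ => hρy⟩
      rw [hpy]
    · have hx₁ : s₁ < ρ x := not_le.1 hx₁
      have hxO : s₀ < ρ x := hs₀₁.trans_lt hx₁
      obtain ⟨-, hpz⟩ := hgO (-(2 * π * u * lam (ρ x))) x hxO hx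
      have hρz : ρ (g (-(2 * π * u * lam (ρ x)), x)) = ρ x := hgρ _ x hxO hx hxR
      have hzR : ρ (g (-(2 * π * u * lam (ρ x)), x)) < R := by rw [hρz]; exact hxR
      have hz0 : p (g (-(2 * π * u * lam (ρ x)), x)) ≠ 0 := by
        rw [hpz]; exact mul_ne_zero (Complex.exp_ne_zero _) hx0
      obtain ⟨hρw, hpw⟩ := hI (-(2 * π * u * (1 - lam (ρ x)))) _ hzR hz0
      refine ⟨?_, fun _ => hρw.trans hρz⟩
      rw [hpw, hpz, exp_mul_I_mul_exp_mul_I_mul]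
      congr 3
      ring
  · have hxR' : R' < ρ x := not_le.1 hxR'
    have hxO : s₀ < ρ x := by linarith
    obtain ⟨-, hpg⟩ := hgO (-(2 * π * u)) x hxO hx
    exact ⟨by rw [hpg], fun hxR => hgρ _ x hxO hx hxR⟩

end ShellInverse

end Literature.Geometry.Manifold

end
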